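import Literature.Analysis.FluidPDE.TaoAveragedJointWeightProofs
import Literature.Analysis.FluidPDE.TaoAveragedFrameTriples
import Literature.Analysis.FluidPDE.TaoAveragedPlaneWaveSynthesisW
import HarnessLib

/-!
# Tao 2016, §3.6–§3.9 about a FRAME TRIPLE: the data of the joint-weight rotation average with the
# base triangle as a parameter (quaternion coordinates)

T. Tao, *Finite time blowup for an averaged three-dimensional Navier–Stokes equation*,
J. Amer. Math. Soc. **29** (2016), 601–674 = arXiv:1402.0290v3, §3.6–§3.9 pp. 18–20, and Remark 3.5
p. 20 ("The averaging over dilation operators was only needed to place the base frequencies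
`ξ⁰₁, ξ⁰₂, ξ⁰₃` in a location where the non-degeneracy condition (3.24) held. This condition in fact
holds for generic `ξ⁰₁, ξ⁰₂, ξ⁰₃`"). HONEST FRAMING (cell harvest/h2-tao-ladder, TAO-LADDER rung
`M_1` — MODEL statements about Tao's averaged equation; nothing here concerns the true Navier–Stokes
equations): this file is the tree's `TaoAveragedJointWeightData.lean` (and the `def`s of
`TaoAveragedJointWeightProofs.lean`) RE-RUN WITH THE BASE TRIPLE `ξ` AS A PARAMETER, for base triples
in frame position (`IsFrameTriple`, `TaoAveragedFrameTriples.lean`: the plane, the direction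
`e₀` of `ξ 2` and the normal `(0,0,1)` of Tao's (3.7) are kept, only the side lengths move), as
needed by the rung-1 crux `SingleScaleNoDilAt` (Theorem 3.2's single-scale step (3.9)/(3.13)
without dilation averaging, for every base triangle with sides in `[4/5, 3/2]` and an input gap).

What is literally reused from the tree (frame position): the parameter space `V ≅ ℍ³`
(`jointE`, `jointMeasure`), the quaternion cut-off `qCut`, the FRAME cut-off `pFrame` (direction of
`ξ₃` near `e₀`, normal near `(0,0,1)`), hence the frame constant and the disintegration constant
`rotDensityConst` with their positivity, the un-rotated frequencies `zetaVec`, the synthesis sum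
`Ssum` (§3.8–3.9, base-free), `Yrot`, `hProd`. What is re-centred at `ξ`: the magnitude cut-offs
`kappaBumpAt` (at `‖ξ j‖`), the un-rotated frequency cut-offs `zetaBumpAt` (at `ξ j`), hence
`pRadAt`, `zCutAt`, `RweightAt`, `realCutAt`, the joint weight `FflatAt`/`jointFAt`, and the
integrands `coreIntegrandAt`, `GfunAt` (with the single-scale weight `φ η_ξ` of `B_{η,ρ,0;ξ}`,
`singleScaleWeightAtC`), `NfunAt`, `fFunAt`, `zCut3At`, the sets `GoodSetAt ξ δ`, `cutSupportAt`.

Proved here: the **localisation lemma about a frame triple** `near_base_of_cutoffs` (on the support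
of the cut-offs the closed frequency triangle is within `5500 ε₀³` of `ξ`, for `ε₀ ≤ 1/100`:
reconstruction of a triangle from its side lengths, the direction of `ξ₃` and the unit normal, with
constants uniform over the window — the height `h ≥ 1/25` of `IsFrameTriple.zero_one_ge` is what
enters); hence **`φ η_ξ ≡ 1` on the support** (`singleScaleWeightAtC_eq_one_of_cutoffs`, for
`ε₀ ≤ 10⁻⁴`; Tao's (3.14)); smoothness of `FflatAt`/`jointFAt` given the non-degeneracy (3.24)
within radius `δ > 6000 ε₀³` of `ξ` (`NondegWithin ξ δ`, supplied for gapped base triples by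
`nondegWithin_of_gap`); compact support.

## References

* T. Tao, J. Amer. Math. Soc. 29 (2016), 601–674, arXiv:1402.0290v3, §3.6 (3.14)–(3.16) p. 18,
  §3.7–3.9 pp. 19–20, Remark 3.5 p. 20. Key `Tao2016AveragedNS`.
-/

noncomputable section

open Real MeasureTheory Quaternion Set FourierTransform
open scoped RealInnerProductSpace Quaternion ENNReal ComplexConjugate SchwartzMap ContDiff

namespace Literature.Analysis.FluidPDE.Tao2016

/-- Local notation for physical / frequency space `ℝ³`. -/
local notation "ℝ³" => EuclideanSpace ℝ (Fin 3)
/-- Local notation for the complexified range `ℂ³`. -/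
local notation "ℂ³" => EuclideanSpace ℂ (Fin 3)
/-- Local notation for the smoothness exponent `C^∞`. -/
local notation "n∞" => ((⊤ : ℕ∞) : WithTop ℕ∞)

open FunctionSpaces.EuclideanSpace (complexify complexify_apply)

attribute [local instance] quatMeasurableSpace quatBorelSpace

/-! ### The cut-offs and the joint weight about a base triple `ξ` -/

section Weight

variable (ξ : Fin 3 → ℝ³) {ε₀ : ℝ} (ψ : Fin 3 → 𝓢(ℝ³, ℂ³)) (X : Fin 3 → ℝ³ → ℂ³)

/-- **The magnitude cut-offs about `ξ`**: smooth bumps around `|ξ j|` equal to `1` within `2ε₀³` and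
supported within `4ε₀³`. [cite: Tao2016AveragedNS, §3.6 p. 18] -/
def kappaBumpAt (hε : 0 < ε₀) (j : Fin 3) : ContDiffBump (‖ξ j‖) :=
  bump2 (‖ξ j‖) (r := 2 * ε₀ ^ 3) (by have := eps_cube_pos hε; linarith)

/-- **The un-rotated frequency cut-offs about `ξ`**: bumps around `ξ j` equal to `1` on
`B̄(ξ j, ε₀³) ⊇ supp ψ̂ⱼ` and supported in `B(ξ j, 2ε₀³)`. [cite: Tao2016AveragedNS, §3.6 p. 18] -/
def zetaBumpAt (hε : 0 < ε₀) (j : Fin 3) : ContDiffBump (ξ j) :=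
  bump2 (ξ j) (r := ε₀ ^ 3) (eps_cube_pos hε)

/-- **The magnitude weight about `ξ`**: `|ξ₁||ξ₂||ξ₃| ∏ⱼ κⱼ(|ξⱼ|)`. [cite: Tao2016AveragedNS, §3.6 p. 18] -/
def pRadAt (hε : 0 < ε₀) (p : ℝ³ × ℝ³) : ℝ :=
  (‖freq3 p 0‖ * ‖freq3 p 1‖ * ‖freq3 p 2‖) *
    ((kappaBumpAt ξ hε 0) ‖freq3 p 0‖ * (kappaBumpAt ξ hε 1) ‖freq3 p 1‖ * (kappaBumpAt ξ hε 2) ‖freq3 p 2‖)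

/-- The cut-off in the un-rotated frequencies `∏ⱼ χⱼ(ζⱼ)` about `ξ`. [cite: Tao2016AveragedNS, §3.6 p. 18] -/
def zCutAt (hε : 0 < ε₀) (q : ℍ × ℍ × ℍ) (p : ℝ³ × ℝ³) : ℝ :=
  (zetaBumpAt ξ hε 0) (zetaVec q p 0) * (zetaBumpAt ξ hε 1) (zetaVec q p 1) * (zetaBumpAt ξ hε 2) (zetaVec q p 2)

/-- The magnitude weight of the disintegration about `ξ`, as `ℝ≥0∞`. [cite: Tao2016AveragedNS, §3.6 p. 18] -/
def RweightAt (hε : 0 < ε₀) (r₁ r₂ r₃ : ℝ) : ℝ≥0∞ :=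
  ENNReal.ofReal ((r₁ * r₂ * r₃) * ((kappaBumpAt ξ hε 0) r₁ * (kappaBumpAt ξ hε 1) r₂ * (kappaBumpAt ξ hε 2) r₃))

/-- **The real cut-off about `ξ`**: `qCut · pRadAt · pFrame · zCutAt / C` (the frame cut-off and the
disintegration constant are the tree's: frame position). [cite: Tao2016AveragedNS, §3.6 p. 18] -/
def realCutAt (hε : 0 < ε₀) (q : ℍ × ℍ × ℍ) (p : ℝ³ × ℝ³) : ℝ :=
  qCut q * pRadAt ξ hε p * pFrame hε p * zCutAt ξ hε q p * (rotDensityConst hε)⁻¹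

/-- **The joint weight about `ξ` on `Q × (ℝ³ × ℝ³)`**: `FflatAt = realCutAt · Ssum`. [cite: Tao2016AveragedNS, §3.6 (3.16) p. 18] -/
def FflatAt (hε : 0 < ε₀) (q : ℍ × ℍ × ℍ) (p : ℝ³ × ℝ³) : ℂ := ((realCutAt ξ hε q p : ℝ) : ℂ) * Ssum ψ q p

/-- **The joint weight `F` about `ξ` on `V × (ℝ³ × ℝ³)`.** [cite: Tao2016AveragedNS, §3.6 (3.16) p. 18] -/
def jointFAt (hε : 0 < ε₀) (x : (Fin 4 → ℝ³) × (ℝ³ × ℝ³)) : ℂ := FflatAt ξ ψ hε (quatTripleEquiv x.1) x.2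

/-- The "good" open set about `ξ` with radius `δ`: `qⱼ ≠ 0` and the frequency triangle within `δ`
of `ξ`. [cite: Tao2016AveragedNS, §3.6 p. 18] -/
def GoodSetAt (δ : ℝ) : Set ((ℍ × ℍ × ℍ) × (ℝ³ × ℝ³)) :=
  {x | (∀ j, slotQ x.1 j ≠ 0) ∧ ∀ j, ‖freq3 x.2 j - ξ j‖ < δ}

/-- The set carrying the real cut-off about `ξ`: `|qⱼ| ∈ [1/2, 2]` and `|ξⱼ' - ξⱼ| ≤ 5500ε₀³`. [cite: Tao2016AveragedNS, §3.6 p. 18] -/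
def cutSupportAt (ε₀ : ℝ) : Set ((ℍ × ℍ × ℍ) × (ℝ³ × ℝ³)) :=
  {x | (∀ j, 1 / 2 ≤ ‖slotQ x.1 j‖ ∧ ‖slotQ x.1 j‖ ≤ 2) ∧ ∀ j, ‖freq3 x.2 j - ξ j‖ ≤ 5500 * ε₀ ^ 3}

/-- The cut-off in the un-rotated frequencies about `ξ` as a function on `(ℝ³)³`. [cite: Tao2016AveragedNS, §3.6 p. 18] -/
def zCut3At (hε : 0 < ε₀) (ζ : ℝ³ × ℝ³ × ℝ³) : ℝ :=
  (zetaBumpAt ξ hε 0) ζ.1 * (zetaBumpAt ξ hε 1) ζ.2.1 * (zetaBumpAt ξ hε 2) ζ.2.2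

/-- The joint-weight integrand `F̃'(q, ζ) Λ_ζ(Y₁, Y₂, Y₃)` about `ξ` (without the weight `w`). [cite: Tao2016AveragedNS, §3.6 p. 18] -/
def coreIntegrandAt (hε : 0 < ε₀) (q : ℍ × ℍ × ℍ) (p : ℝ³ × ℝ³) : ℂ :=
  FflatAt ξ ψ hε q p * Λ (freq3 p 0) (freq3 p 1) (Yrot X q p 0) (Yrot X q p 1) (Yrot X q p 2)

/-- **The full integrand about `ξ`**: `G(q, ζ) = ∏g₀(|qⱼ|) · (φη_ξ)(ζ) F̃'(q, ζ) Λ_ζ(Y)`. [cite: Tao2016AveragedNS, §3.6 (3.16) p. 18] -/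
def GfunAt (hε : 0 < ε₀) (x : (ℍ × ℍ × ℍ) × (ℝ³ × ℝ³)) : ℂ :=
  ((qDensity x.1 : ℝ) : ℂ) * (singleScaleWeightAtC ξ ε₀ x.2 * coreIntegrandAt ξ ψ X hε x.1 x.2)

/-- **The reduced integrand about `ξ`**: `N(q, ζ) = ∏g₀(|qⱼ|) realCutAt(q, ζ) ∏ⱼ Xⱼ(ζⱼ)·P aⱼ(ζⱼ)`. [cite: Tao2016AveragedNS, §3.6 (3.15) p. 18] -/
def NfunAt (hε : 0 < ε₀) (x : (ℍ × ℍ × ℍ) × (ℝ³ × ℝ³)) : ℂ :=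
  ((qDensity x.1 * realCutAt ξ hε x.1 x.2 : ℝ) : ℂ) * hProd ψ X (rotFreq x)

/-- The normalised separated weight about `ξ`: `f(ζ) = C⁻¹ χ(ζ) ∏ⱼ Xⱼ(ζⱼ)·P aⱼ(ζⱼ)`. [cite: Tao2016AveragedNS, §3.6 p. 18] -/
def fFunAt (hε : 0 < ε₀) (ζ : ℝ³ × ℝ³ × ℝ³) : ℂ :=
  ((((rotDensityConst hε)⁻¹ * zCut3At ξ hε ζ : ℝ)) : ℂ) * hProd ψ X ζ

/-- `zCutAt = zCut3At ∘ rotFreq`. [cite: Tao2016AveragedNS, §3.6 p. 18] -/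
theorem zCutAt_eq_zCut3At (hε : 0 < ε₀) (q : ℍ × ℍ × ℍ) (p : ℝ³ × ℝ³) :
    zCutAt ξ hε q p = zCut3At ξ hε (rotFreq (q, p)) := rfl

/-- The outer radii of the magnitude cut-offs. [cite: Tao2016AveragedNS, §3.6 p. 18] -/
theorem kappaBumpAt_rOut (hε : 0 < ε₀) (j : Fin 3) : (kappaBumpAt ξ hε j).rOut = 4 * ε₀ ^ 3 := by
  show 2 * (2 * ε₀ ^ 3) = 4 * ε₀ ^ 3; ring

/-- The inner radii of the magnitude cut-offs. [cite: Tao2016AveragedNS, §3.6 p. 18] -/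
theorem kappaBumpAt_rIn (hε : 0 < ε₀) (j : Fin 3) : (kappaBumpAt ξ hε j).rIn = 2 * ε₀ ^ 3 := rfl

/-- The outer radii of the frequency cut-offs. [cite: Tao2016AveragedNS, §3.6 p. 18] -/
theorem zetaBumpAt_rOut (hε : 0 < ε₀) (j : Fin 3) : (zetaBumpAt ξ hε j).rOut = 2 * ε₀ ^ 3 := rfl

/-- The inner radii of the frequency cut-offs. [cite: Tao2016AveragedNS, §3.6 p. 18] -/
theorem zetaBumpAt_rIn (hε : 0 < ε₀) (j : Fin 3) : (zetaBumpAt ξ hε j).rIn = ε₀ ^ 3 := rfl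

end Weight

/-! ### The localisation lemma about a frame triple -/

section Localisation

variable {ξ : Fin 3 → ℝ³} {ε₀ : ℝ}

/-- **Magnitudes on the support of `pRadAt`**: each `|ξⱼ'|` is within `4ε₀³` of `|ξ j|` and non-zero
(when `ξ j ≠ 0` and `ε₀ ≤ 1/10`). [cite: Tao2016AveragedNS, §3.6 p. 18] -/
theorem radii_of_pRadAt_ne_zero (hε : 0 < ε₀) {p : ℝ³ × ℝ³} (h : pRadAt ξ hε p ≠ 0) (j : Fin 3) :
    |‖freq3 p j‖ - ‖ξ j‖| < 4 * ε₀ ^ 3 ∧ freq3 p j ≠ 0 := by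
  unfold pRadAt at h
  simp only [mul_ne_zero_iff] at h
  obtain ⟨⟨⟨n0, n1⟩, n2⟩, ⟨⟨k0, k1⟩, k2⟩⟩ := h
  have hk : (kappaBumpAt ξ hε j) ‖freq3 p j‖ ≠ 0 := by
    fin_cases j
    · exact k0
    · exact k1
    · exact k2
  have hn : ‖freq3 p j‖ ≠ 0 := by
    fin_cases j
    · exact n0
    · exact n1
    · exact n2
  refine ⟨?_, norm_ne_zero_iff.mp hn⟩
  have := bump_dist_lt_of_ne_zero (kappaBumpAt ξ hε j) hk
  rwa [kappaBumpAt_rOut, Real.dist_eq] at this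

/-- Squares of nearby radii in the window: `|r² - s²| ≤ 13t` for `|r - s| < 4t`, `s ≤ 3/2`,
`t ≤ 10⁻⁶`; and the perturbed radius stays in `[79/100, 151/100]`. [folklore] -/
private theorem sq_sub_sq_estimate {t r s : ℝ} (ht0 : 0 < t) (ht1 : t ≤ 1 / 1000000) (hs1 : 4 / 5 ≤ s)
    (hs2 : s ≤ 3 / 2) (h : |r - s| < 4 * t) :
    |r ^ 2 - s ^ 2| ≤ 13 * t ∧ 79 / 100 ≤ r ∧ r ≤ 151 / 100 := by
  obtain ⟨h1, h2⟩ := abs_lt.mp h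
  refine ⟨?_, by linarith, by linarith⟩
  rw [abs_le]
  constructor <;> nlinarith

/-- The first frame coordinate: with `ip = ⟪ξ₁', ξ₃'⟫ = (r₂²-r₁²-r₃²)/2` near `ip₀ = c α`,
`|ip/r₃ - α| ≤ 65t`. [folklore] -/
private theorem alpha_estimate {t r₁ r₂ r₃ a b c α : ℝ} (ht0 : 0 < t)
    (hq1 : |r₁ ^ 2 - a ^ 2| ≤ 13 * t) (hq2 : |r₂ ^ 2 - b ^ 2| ≤ 13 * t) (hq3 : |r₃ ^ 2 - c ^ 2| ≤ 13 * t)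
    (hr3 : 79 / 100 ≤ r₃) (hc1 : 4 / 5 ≤ c) (hc2 : c ≤ 3 / 2) (hr3c : |r₃ - c| < 4 * t) (hα : |α| ≤ 3 / 2)
    (hcα : c * α = (b ^ 2 - a ^ 2 - c ^ 2) / 2) :
    |(r₂ ^ 2 - r₁ ^ 2 - r₃ ^ 2) / 2 / r₃ - α| ≤ 65 * t := by
  set ip := (r₂ ^ 2 - r₁ ^ 2 - r₃ ^ 2) / 2 with hip
  set ip₀ := (b ^ 2 - a ^ 2 - c ^ 2) / 2 with hip₀
  have hdiff : |ip - ip₀| ≤ 20 * t := by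
    rw [hip, hip₀, abs_le]
    obtain ⟨a1, a2⟩ := abs_le.mp hq1
    obtain ⟨b1, b2⟩ := abs_le.mp hq2
    obtain ⟨c1, c2⟩ := abs_le.mp hq3
    constructor <;> linarith
  have hip₀b : |ip₀| ≤ 9 / 4 := by
    rw [← hcα, abs_mul, abs_of_pos (by linarith)]
    calc c * |α| ≤ 3 / 2 * (3 / 2) := mul_le_mul hc2 hα (abs_nonneg _) (by norm_num)
      _ = 9 / 4 := by norm_num
  have hr3pos : 0 < r₃ := by linarith
  have hcpos : 0 < c := by linarith
  have hαeq : α = ip₀ / c := by rw [← hcα]; field_simp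
  rw [hαeq, div_sub_div _ _ hr3pos.ne' hcpos.ne', abs_div, abs_of_pos (mul_pos hr3pos hcpos),
    div_le_iff₀ (mul_pos hr3pos hcpos)]
  have hnum : |ip * c - r₃ * ip₀| ≤ 39 * t := by
    rw [show ip * c - r₃ * ip₀ = (ip - ip₀) * c + ip₀ * (c - r₃) by ring]
    calc _ ≤ |(ip - ip₀) * c| + |ip₀ * (c - r₃)| := abs_add_le _ _
      _ = |ip - ip₀| * c + |ip₀| * |c - r₃| := by rw [abs_mul, abs_mul, abs_of_pos hcpos]
      _ ≤ 20 * t * (3 / 2) + 9 / 4 * (4 * t) := by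
          gcongr
          rw [abs_sub_comm]; exact hr3c.le
      _ = 39 * t := by ring
  calc |ip * c - r₃ * ip₀| ≤ 39 * t := hnum
    _ ≤ 65 * t * (79 / 100 * (4 / 5)) := by nlinarith
    _ ≤ 65 * t * (r₃ * c) := by
        apply mul_le_mul_of_nonneg_left _ (by positivity)
        exact mul_le_mul hr3 hc1 (by norm_num) hr3pos.le

/-- The second frame coordinate: `u = |ξ₃' × ξ₁'|/r₃ = √(r₁² - (ip/r₃)²)` is within `5300t` of the
height `h = √(a² - α²) ≥ 1/25`. [folklore] -/
private theorem height_estimate {t r₁ r₃ a α h nc ip : ℝ} (ht0 : 0 < t) (ht1 : t ≤ 1 / 1000000)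
    (hr3 : 79 / 100 ≤ r₃) (hnc : 0 ≤ nc) (hlag : nc ^ 2 = r₃ ^ 2 * r₁ ^ 2 - ip ^ 2)
    (hq1 : |r₁ ^ 2 - a ^ 2| ≤ 13 * t) (hA : |ip / r₃ - α| ≤ 65 * t) (hα : |α| ≤ 3 / 2)
    (hh : 1 / 25 ≤ h) (hh2 : h ^ 2 = a ^ 2 - α ^ 2) : |-(nc / r₃) + h| ≤ 5300 * t := by
  have hr3pos : 0 < r₃ := by linarith
  set A := ip / r₃ with hAdef
  set u := nc / r₃ with hu
  have hu0 : 0 ≤ u := div_nonneg hnc hr3pos.le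
  have hu2 : u ^ 2 = r₁ ^ 2 - A ^ 2 := by
    rw [hu, hAdef, div_pow, div_pow, hlag]
    field_simp
  have hA2 : |A ^ 2 - α ^ 2| ≤ 196 * t := by
    rw [show A ^ 2 - α ^ 2 = (A - α) * (A + α) by ring, abs_mul]
    have hsum : |A + α| ≤ 3 + 65 * t := by
      calc |A + α| = |(A - α) + 2 * α| := by ring_nf
        _ ≤ |A - α| + |2 * α| := abs_add_le _ _
        _ ≤ 65 * t + 2 * (3 / 2) := by
            rw [abs_mul, abs_two]
            exact add_le_add hA (by linarith)
        _ = 3 + 65 * t := by ring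
    calc |A - α| * |A + α| ≤ 65 * t * (3 + 65 * t) :=
          mul_le_mul hA hsum (abs_nonneg _) (by positivity)
      _ ≤ 196 * t := by nlinarith
  have hd : |u ^ 2 - h ^ 2| ≤ 209 * t := by
    rw [hu2, hh2, show r₁ ^ 2 - A ^ 2 - (a ^ 2 - α ^ 2) = (r₁ ^ 2 - a ^ 2) - (A ^ 2 - α ^ 2) by ring]
    calc _ ≤ |r₁ ^ 2 - a ^ 2| + |A ^ 2 - α ^ 2| := abs_sub _ _
      _ ≤ 13 * t + 196 * t := add_le_add hq1 hA2
      _ = 209 * t := by ring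
  have hprod : |u - h| * (u + h) = |u ^ 2 - h ^ 2| := by
    rw [show u ^ 2 - h ^ 2 = (u - h) * (u + h) by ring, abs_mul,
      abs_of_pos (by linarith : 0 < u + h)]
  have hkey : |u - h| * (1 / 25) ≤ 209 * t := by
    calc |u - h| * (1 / 25) ≤ |u - h| * (u + h) := by
          apply mul_le_mul_of_nonneg_left _ (abs_nonneg _); linarith
      _ = |u ^ 2 - h ^ 2| := hprod
      _ ≤ 209 * t := hd
  rw [show -u + h = -(u - h) by ring, abs_neg]
  linarith

/-- Step A of the localisation: `ξ₃'` from its magnitude and direction, `|ξ₃' - ξ 2| ≤ 6t`. [folklore] -/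
private theorem near_base_two_of_frame (hξ : IsFrameTriple ξ) {t : ℝ} (ht : 0 ≤ t) {v : ℝ³} (hv : v ≠ 0)
    (hr : |‖v‖ - ‖ξ 2‖| < 4 * t) (he : ‖udir v - ksE0‖ < t) : ‖v - ξ 2‖ ≤ 6 * t := by
  have he1 : ‖udir v‖ = 1 := norm_udir hv
  have hc : ‖ξ 2‖ ≤ 3 / 2 := (hξ.window 2).2
  have e3 : v - ξ 2 = (‖v‖ - ‖ξ 2‖) • udir v + ‖ξ 2‖ • (udir v - ksE0) := by
    rw [sub_smul, smul_sub, ← eq_norm_smul_udir hv, ← hξ.two_eq]; abel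
  rw [e3]
  calc _ ≤ ‖(‖v‖ - ‖ξ 2‖) • udir v‖ + ‖‖ξ 2‖ • (udir v - ksE0)‖ := norm_add_le _ _
    _ = |‖v‖ - ‖ξ 2‖| * 1 + ‖ξ 2‖ * ‖udir v - ksE0‖ := by
        rw [norm_smul, norm_smul, Real.norm_eq_abs, he1, Real.norm_eq_abs, abs_of_nonneg (norm_nonneg _)]
    _ ≤ 4 * t * 1 + 3 / 2 * t := by
        gcongr
    _ ≤ 6 * t := by linarith

/-- Step B of the localisation: `ξ₁'` from its frame coordinates, `|ξ₁' - ξ 0| ≤ 5400t`. [folklore] -/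
private theorem near_base_zero_of_frame (hξ : IsFrameTriple ξ) {t : ℝ} (ht : 0 ≤ t) {p₁ e m : ℝ³}
    (he1 : ‖e‖ = 1) (hm1 : ‖m‖ = 1)
    (hexp : p₁ = ⟪p₁, e⟫ • e + ⟪p₁, cross e m⟫ • cross e m)
    (hα : |⟪p₁, e⟫ - ξ 0 0| ≤ 65 * t) (hγ : |⟪p₁, cross e m⟫ + ξ 0 1| ≤ 5300 * t)
    (he : ‖e - ksE0‖ < t) (hm : ‖m - northVec‖ < t) : ‖p₁ - ξ 0‖ ≤ 5400 * t := by
  have hαb : |ξ 0 0| ≤ 3 / 2 := hξ.abs_zero_zero_le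
  have hhb : ξ 0 1 ≤ 3 / 2 := hξ.zero_one_le
  have hh0 : 0 < ξ 0 1 := hξ.zero_one
  have hc1 : cross (e - ksE0) m = cross e m - cross ksE0 m := by
    ext i; fin_cases i <;> simp [cross_apply_zero, cross_apply_one, cross_apply_two] <;> ring
  have hc2 : cross ksE0 (m - northVec) = cross ksE0 m - cross ksE0 northVec := by
    ext i; fin_cases i <;> simp [cross_apply_zero, cross_apply_one, cross_apply_two] <;> ring
  have e1 : p₁ - ξ 0 = (⟪p₁, e⟫ - ξ 0 0) • e + (⟪p₁, cross e m⟫ + ξ 0 1) • cross e m +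
      (ξ 0 0) • (e - ksE0) - (ξ 0 1) • (cross (e - ksE0) m + cross ksE0 (m - northVec)) := by
    conv_lhs => rw [hexp, hξ.zero_eq]
    rw [hc1, hc2]
    simp only [smul_sub, smul_add, sub_smul, add_smul]
    abel
  rw [e1]
  have hem : ‖cross e m‖ ≤ 1 := by
    calc ‖cross e m‖ ≤ ‖e‖ * ‖m‖ := norm_cross_le_norm_mul _ _
      _ = 1 := by rw [he1, hm1, one_mul]
  have h3 : ‖cross (e - ksE0) m‖ ≤ t := by
    calc ‖cross (e - ksE0) m‖ ≤ ‖e - ksE0‖ * ‖m‖ := norm_cross_le_norm_mul _ _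
      _ ≤ t * 1 := by rw [hm1]; exact mul_le_mul_of_nonneg_right he.le zero_le_one
      _ = t := mul_one t
  have h4 : ‖cross ksE0 (m - northVec)‖ ≤ t := by
    calc ‖cross ksE0 (m - northVec)‖ ≤ ‖ksE0‖ * ‖m - northVec‖ := norm_cross_le_norm_mul _ _
      _ ≤ 1 * t := by rw [norm_ksE0]; exact mul_le_mul_of_nonneg_left hm.le zero_le_one
      _ = t := one_mul t
  have hT1 : ‖(⟪p₁, e⟫ - ξ 0 0) • e‖ ≤ 65 * t := by
    rw [norm_smul, Real.norm_eq_abs, he1, mul_one]; exact hα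
  have hT2 : ‖(⟪p₁, cross e m⟫ + ξ 0 1) • cross e m‖ ≤ 5300 * t := by
    rw [norm_smul, Real.norm_eq_abs]
    calc _ ≤ 5300 * t * 1 := mul_le_mul hγ hem (norm_nonneg _) (by positivity)
      _ = 5300 * t := mul_one _
  have hT3 : ‖(ξ 0 0) • (e - ksE0)‖ ≤ 3 / 2 * t := by
    rw [norm_smul, Real.norm_eq_abs]
    exact mul_le_mul hαb he.le (norm_nonneg _) (by norm_num)
  have hT4 : ‖(ξ 0 1) • (cross (e - ksE0) m + cross ksE0 (m - northVec))‖ ≤ 3 / 2 * (t + t) := by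
    rw [norm_smul, Real.norm_eq_abs, abs_of_pos hh0]
    exact mul_le_mul hhb ((norm_add_le _ _).trans (add_le_add h3 h4)) (norm_nonneg _) (by norm_num)
  calc _ ≤ ‖(⟪p₁, e⟫ - ξ 0 0) • e + (⟪p₁, cross e m⟫ + ξ 0 1) • cross e m + (ξ 0 0) • (e - ksE0)‖ +
        ‖(ξ 0 1) • (cross (e - ksE0) m + cross ksE0 (m - northVec))‖ := norm_sub_le _ _
    _ ≤ (‖(⟪p₁, e⟫ - ξ 0 0) • e‖ + ‖(⟪p₁, cross e m⟫ + ξ 0 1) • cross e m‖ + ‖(ξ 0 0) • (e - ksE0)‖) +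
        ‖(ξ 0 1) • (cross (e - ksE0) m + cross ksE0 (m - northVec))‖ := by
        gcongr; exact norm_add₃_le
    _ ≤ (65 * t + 5300 * t + 3 / 2 * t) + 3 / 2 * (t + t) := by gcongr
    _ ≤ 5400 * t := by linarith

/-- **The localisation lemma about a frame triple.** If `ε₀ ≤ 1/100` and the magnitude and frame
cut-offs do not vanish at `(ξ₁', ξ₂')`, then the closed triangle `(ξ₁', ξ₂', ξ₃')` is within
`5500 ε₀³` of the base: `|ξⱼ' - ξ j| ≤ 5500 ε₀³` for all `j`. (Reconstruction of a triangle from its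
side lengths, the direction of one side and its unit normal; the constant is uniform over the window
because the height of the base triangle over its third side is `≥ 1/25`.) This is what makes Tao's
weight `φ η_ξ` identically `1` on the support (cf. (3.14)) and puts the triangle in the range of the
non-degeneracy (3.24). [cite: Tao2016AveragedNS, §3.6 (3.14) p. 18] -/
theorem near_base_of_cutoffs (hξ : IsFrameTriple ξ) (hε : 0 < ε₀) (hε1 : ε₀ ≤ 1 / 100) {p : ℝ³ × ℝ³}
    (hR : pRadAt ξ hε p ≠ 0) (hB : pFrame hε p ≠ 0) : ∀ j, ‖freq3 p j - ξ j‖ ≤ 5500 * ε₀ ^ 3 := by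
  have ht0 : 0 < ε₀ ^ 3 := eps_cube_pos hε
  have ht1 : ε₀ ^ 3 ≤ 1 / 1000000 := by
    calc ε₀ ^ 3 ≤ (1 / 100) ^ 3 := by gcongr
      _ = 1 / 1000000 := by norm_num
  obtain ⟨p₁, p₂⟩ := p
  -- data on the support
  obtain ⟨hr1, hp₁0⟩ := radii_of_pRadAt_ne_zero hε hR 0
  obtain ⟨hr2, -⟩ := radii_of_pRadAt_ne_zero hε hR 1
  obtain ⟨hr3, hp₃0⟩ := radii_of_pRadAt_ne_zero hε hR 2
  rw [freq3_zero] at hr1 hp₁0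
  rw [freq3_one] at hr2
  rw [freq3_two] at hr3 hp₃0
  obtain ⟨he, hm⟩ := frame_of_pFrame_ne_zero hε hB
  rw [freq3_two] at he
  -- the frame
  have hm0 : cross p₁ p₂ ≠ 0 := by
    intro h0
    have : nVec (p₁, p₂) = 0 := by rw [nVec_eq, h0, udir, norm_zero, inv_zero, zero_smul]
    rw [this, zero_sub, norm_neg, norm_northVec] at hm
    linarith
  have hc0 : cross (-p₁ - p₂) p₁ ≠ 0 := by rw [← cross_eq_cross_close]; exact hm0
  have hmn : nVec (p₁, p₂) = udir (cross (-p₁ - p₂) p₁) := by rw [nVec_eq, cross_eq_cross_close]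
  have hm1 : ‖nVec (p₁, p₂)‖ = 1 := by rw [hmn]; exact norm_udir hc0
  have he1 : ‖udir (-p₁ - p₂)‖ = 1 := norm_udir hp₃0
  have hm_p₁ : ⟪nVec (p₁, p₂), p₁⟫ = 0 := inner_gammaNormal_zero (freq3 (p₁, p₂))
  have hm_p₃ : ⟪nVec (p₁, p₂), -p₁ - p₂⟫ = 0 := inner_gammaNormal_two (freq3_sum (p₁, p₂))
  -- arithmetic of the side lengths
  obtain ⟨hq1, hr1lo, hr1hi⟩ := sq_sub_sq_estimate ht0 ht1 (hξ.window 0).1 (hξ.window 0).2 hr1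
  obtain ⟨hq2, -, -⟩ := sq_sub_sq_estimate ht0 ht1 (hξ.window 1).1 (hξ.window 1).2 hr2
  obtain ⟨hq3, hr3lo, hr3hi⟩ := sq_sub_sq_estimate ht0 ht1 (hξ.window 2).1 (hξ.window 2).2 hr3
  have hlaw : ⟪p₁, -p₁ - p₂⟫ = (‖p₂‖ ^ 2 - ‖p₁‖ ^ 2 - ‖-p₁ - p₂‖ ^ 2) / 2 := by
    have h2 : ‖p₂‖ = ‖p₁ + (-p₁ - p₂)‖ := by
      rw [show p₁ + (-p₁ - p₂) = -p₂ by abel, norm_neg]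
    have : ‖p₂‖ ^ 2 = ‖p₁‖ ^ 2 + 2 * ⟪p₁, -p₁ - p₂⟫ + ‖-p₁ - p₂‖ ^ 2 := by
      rw [h2, ← real_inner_self_eq_norm_sq, inner_add_left, inner_add_right, inner_add_right,
        real_inner_self_eq_norm_sq, real_inner_self_eq_norm_sq, real_inner_comm (-p₁ - p₂) p₁]
      ring
    linarith
  have hcα : ‖ξ 2‖ * ξ 0 0 = (‖ξ 1‖ ^ 2 - ‖ξ 0‖ ^ 2 - ‖ξ 2‖ ^ 2) / 2 := by
    have h := hξ.two_zero_mul_zero_zero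
    rwa [← hξ.norm_two] at h
  -- Step A
  have hA : ‖(-p₁ - p₂) - ξ 2‖ ≤ 6 * ε₀ ^ 3 := near_base_two_of_frame hξ ht0.le hp₃0 hr3 he
  -- Step B
  have hαest : |⟪p₁, udir (-p₁ - p₂)⟫ - ξ 0 0| ≤ 65 * ε₀ ^ 3 := by
    rw [inner_udir_right, hlaw, show ‖-p₁ - p₂‖⁻¹ * ((‖p₂‖ ^ 2 - ‖p₁‖ ^ 2 - ‖-p₁ - p₂‖ ^ 2) / 2) =
      (‖p₂‖ ^ 2 - ‖p₁‖ ^ 2 - ‖-p₁ - p₂‖ ^ 2) / 2 / ‖-p₁ - p₂‖ by rw [inv_mul_eq_div]]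
    exact alpha_estimate ht0 hq1 hq2 hq3 hr3lo (hξ.window 2).1 (hξ.window 2).2 hr3 hξ.abs_zero_zero_le hcα
  have hγ : |⟪p₁, cross (udir (-p₁ - p₂)) (nVec (p₁, p₂))⟫ + ξ 0 1| ≤ 5300 * ε₀ ^ 3 := by
    rw [hmn, inner_cross_frame_eq hp₃0 hc0]
    have hlag : ‖cross (-p₁ - p₂) p₁‖ ^ 2 = ‖-p₁ - p₂‖ ^ 2 * ‖p₁‖ ^ 2 - ⟪p₁, -p₁ - p₂⟫ ^ 2 := by
      rw [norm_cross_sq, real_inner_comm p₁ (-p₁ - p₂)]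
    have hA' : |⟪p₁, -p₁ - p₂⟫ / ‖-p₁ - p₂‖ - ξ 0 0| ≤ 65 * ε₀ ^ 3 := by
      rw [div_eq_inv_mul, ← inner_udir_right]; exact hαest
    exact height_estimate ht0 ht1 hr3lo (norm_nonneg _) hlag hq1 hA' hξ.abs_zero_zero_le hξ.zero_one_ge
      (by rw [← hξ.sq_add_sq]; ring)
  have hexp : p₁ = ⟪p₁, udir (-p₁ - p₂)⟫ • udir (-p₁ - p₂) +
      ⟪p₁, cross (udir (-p₁ - p₂)) (nVec (p₁, p₂))⟫ • cross (udir (-p₁ - p₂)) (nVec (p₁, p₂)) := by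
    have h := real_frame_expansion hp₃0 hm1 hm_p₃ p₁
    rw [real_inner_comm (nVec (p₁, p₂)) p₁, hm_p₁, zero_smul, add_zero] at h
    exact h
  have hBstep : ‖p₁ - ξ 0‖ ≤ 5400 * ε₀ ^ 3 := near_base_zero_of_frame hξ ht0.le he1 hm1 hexp hαest hγ he hm
  -- Step C: `ξ₂' = -ξ₁' - ξ₃'`
  have hCstep : ‖p₂ - ξ 1‖ ≤ 5406 * ε₀ ^ 3 := by
    have hxi : ξ 1 = -ξ 0 - ξ 2 := by
      have h := hξ.sum
      calc ξ 1 = (ξ 0 + ξ 1 + ξ 2) - ξ 0 - ξ 2 := by abel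
        _ = -ξ 0 - ξ 2 := by rw [h]; abel
    have : p₂ - ξ 1 = -(p₁ - ξ 0) - ((-p₁ - p₂) - ξ 2) := by rw [hxi]; abel
    rw [this]
    calc _ ≤ ‖-(p₁ - ξ 0)‖ + ‖(-p₁ - p₂) - ξ 2‖ := norm_sub_le _ _
      _ ≤ 5400 * ε₀ ^ 3 + 6 * ε₀ ^ 3 := by rw [norm_neg]; exact add_le_add hBstep hA
      _ = 5406 * ε₀ ^ 3 := by ring
  intro j
  fin_cases j
  · exact hBstep.trans (by linarith)
  · exact hCstep.trans (by linarith)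
  · exact hA.trans (by linarith)

end Localisation

/-! ### Tao's weight `φ η_ξ` is identically one on the support of the cut-offs -/

section WeightOne

variable {ξ : Fin 3 → ℝ³} {ε₀ : ℝ}

/-- Ratios of nearby radii in the window: `|r₂/r₁ - b/a| ≤ 19t`. [folklore] -/
private theorem ratio_estimate {t r₁ r₂ a b : ℝ} (ht0 : 0 < t) (ht1 : t ≤ 1 / 1000000)
    (ha1 : 4 / 5 ≤ a) (ha2 : a ≤ 3 / 2) (hb1 : 4 / 5 ≤ b) (hb2 : b ≤ 3 / 2)
    (h1 : |r₁ - a| < 4 * t) (h2 : |r₂ - b| < 4 * t) : |r₂ / r₁ - b / a| ≤ 19 * t := by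
  obtain ⟨h1a, h1b⟩ := abs_lt.mp h1
  obtain ⟨h2a, h2b⟩ := abs_lt.mp h2
  have hr1 : 0 < r₁ := by linarith
  have ha : 0 < a := by linarith
  rw [div_sub_div _ _ hr1.ne' ha.ne', abs_div, abs_of_pos (mul_pos hr1 ha), div_le_iff₀ (mul_pos hr1 ha)]
  have hnum : |r₂ * a - r₁ * b| ≤ 12 * t := by
    rw [show r₂ * a - r₁ * b = a * (r₂ - b) - b * (r₁ - a) by ring]
    calc _ ≤ |a * (r₂ - b)| + |b * (r₁ - a)| := abs_sub _ _
      _ = a * |r₂ - b| + b * |r₁ - a| := by rw [abs_mul, abs_mul, abs_of_pos ha, abs_of_pos (by linarith : 0 < b)]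
      _ ≤ 3 / 2 * (4 * t) + 3 / 2 * (4 * t) := by gcongr
      _ = 12 * t := by ring
  calc |r₂ * a - r₁ * b| ≤ 12 * t := hnum
    _ ≤ 19 * t * (79 / 100 * (4 / 5)) := by nlinarith
    _ ≤ 19 * t * (r₁ * a) := by
        apply mul_le_mul_of_nonneg_left _ (by positivity)
        exact mul_le_mul (by linarith) ha1 (by norm_num) hr1.le

/-- **`φ η_ξ ≡ 1` on the support** (Tao, after (3.14): "the weight `w(R₁ξ₁,R₂ξ₂,R₃ξ₃)` appearing in
(3.12) is equal to one (for `ε₀` small enough)"), about a frame triple: if `ε₀ ≤ 10⁻⁴` and the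
magnitude and frame cut-offs do not vanish at `ζ`, then `singleScaleWeightAtC ξ ε₀ ζ = 1`.
[cite: Tao2016AveragedNS, §3.6 (3.14) p. 18] -/
theorem singleScaleWeightAtC_eq_one_of_cutoffs (hξ : IsFrameTriple ξ) (hε : 0 < ε₀) (hε1 : ε₀ ≤ 1 / 10000)
    {p : ℝ³ × ℝ³} (hR : pRadAt ξ hε p ≠ 0) (hB : pFrame hε p ≠ 0) : singleScaleWeightAtC ξ ε₀ p = 1 := by
  have ht0 : 0 < ε₀ ^ 3 := eps_cube_pos hε
  have hε2 : 0 < ε₀ ^ 2 := pow_pos hε 2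
  have ht1 : ε₀ ^ 3 ≤ 1 / 1000000 := by
    calc ε₀ ^ 3 ≤ (1 / 100) ^ 3 := by gcongr; linarith
      _ = 1 / 1000000 := by norm_num
  have hcube : 5500 * ε₀ ^ 3 ≤ ε₀ ^ 2 := by
    rw [pow_succ]; nlinarith
  have hcube' : 19 * ε₀ ^ 3 ≤ 10 * ε₀ ^ 2 := by
    rw [pow_succ]; nlinarith
  have hnear := near_base_of_cutoffs hξ hε (by linarith) hR hB
  obtain ⟨hr1, hp1⟩ := radii_of_pRadAt_ne_zero hε hR 0
  obtain ⟨hr2, -⟩ := radii_of_pRadAt_ne_zero hε hR 1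
  obtain ⟨hr3, -⟩ := radii_of_pRadAt_ne_zero hε hR 2
  rw [freq3_zero] at hr1 hp1
  rw [freq3_one] at hr2
  rw [freq3_two] at hr3
  have e1 : freqCutoff (‖p.1 - ξ 0‖ / ε₀ ^ 2) = 1 := by
    apply freqCutoff_eq_one
    rw [abs_div, abs_of_pos hε2, abs_of_nonneg (norm_nonneg _), div_le_one hε2]
    have := hnear 0
    rw [freq3_zero] at this
    linarith
  have e2 : freqCutoff ((‖p.2‖ / ‖p.1‖ - ‖ξ 1‖ / ‖ξ 0‖) / (10 * ε₀ ^ 2)) = 1 := by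
    apply freqCutoff_eq_one
    rw [abs_div, abs_of_pos (by positivity : (0 : ℝ) < 10 * ε₀ ^ 2), div_le_one (by positivity)]
    exact (ratio_estimate ht0 ht1 (hξ.window 0).1 (hξ.window 0).2 (hξ.window 1).1 (hξ.window 1).2 hr1 hr2).trans
      hcube'
  have e3 : freqCutoff ((‖-p.1 - p.2‖ / ‖p.1‖ - ‖ξ 2‖ / ‖ξ 0‖) / (10 * ε₀ ^ 2)) = 1 := by
    apply freqCutoff_eq_one
    rw [abs_div, abs_of_pos (by positivity : (0 : ℝ) < 10 * ε₀ ^ 2), div_le_one (by positivity)]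
    exact (ratio_estimate ht0 ht1 (hξ.window 0).1 (hξ.window 0).2 (hξ.window 2).1 (hξ.window 2).2 hr1 hr3).trans
      hcube'
  unfold singleScaleWeightAtC etaAt
  rw [e1, e2, e3, one_mul, one_mul, Complex.ofReal_one]

end WeightOne

/-! ### Smoothness of the joint weight about `ξ` -/

section Smooth

variable {ξ : Fin 3 → ℝ³} {ε₀ δ : ℝ} (ψ : Fin 3 → 𝓢(ℝ³, ℂ³))

/-- The good set about `ξ` is open. [cite: Tao2016AveragedNS, §3.6 p. 18] -/
theorem isOpen_goodSetAt (ξ : Fin 3 → ℝ³) (δ : ℝ) : IsOpen (GoodSetAt ξ δ) := by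
  have h1 : ∀ j, IsOpen {x : (ℍ × ℍ × ℍ) × (ℝ³ × ℝ³) | slotQ x.1 j ≠ 0} := fun j =>
    isOpen_ne.preimage ((contDiff_slotQ j).continuous.comp continuous_fst)
  have h2 : ∀ j, IsOpen {x : (ℍ × ℍ × ℍ) × (ℝ³ × ℝ³) | ‖freq3 x.2 j - ξ j‖ < δ} := fun j =>
    isOpen_lt (((contDiff_freq3_apply j).continuous.comp continuous_snd).sub continuous_const).norm
      continuous_const
  have : GoodSetAt ξ δ = (⋂ j, {x | slotQ x.1 j ≠ 0}) ∩ ⋂ j, {x | ‖freq3 x.2 j - ξ j‖ < δ} := by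
    ext x; simp [GoodSetAt]
  rw [this]
  exact (isOpen_iInter_of_finite h1).inter (isOpen_iInter_of_finite h2)

variable {ψ}

/-- **Smoothness of the real cut-off about `ξ` on the good set** (given (3.24) within `δ`). [cite: Tao2016AveragedNS, §3.6 p. 18] -/
theorem contDiffAt_realCutAt (hε : 0 < ε₀) (hnd : NondegWithin ξ δ) {x : (ℍ × ℍ × ℍ) × (ℝ³ × ℝ³)}
    (hx : x ∈ GoodSetAt ξ δ) :
    ContDiffAt ℝ n∞ (fun y : (ℍ × ℍ × ℍ) × (ℝ³ × ℝ³) => realCutAt ξ hε y.1 y.2) x := by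
  obtain ⟨hq, hp⟩ := hx
  obtain ⟨hne, hcr, -, -, -⟩ := hnd (freq3 x.2) hp (freq3_sum x.2)
  -- the pieces
  have hnorm : ∀ j, ContDiffAt ℝ n∞ (fun y : (ℍ × ℍ × ℍ) × (ℝ³ × ℝ³) => ‖freq3 y.2 j‖) x := fun j =>
    (contDiffAt_norm ℝ (hne j)).comp x ((contDiff_freq3_apply j).contDiffAt.comp x contDiffAt_snd)
  have hqCut : ContDiffAt ℝ n∞ (fun y : (ℍ × ℍ × ℍ) × (ℝ³ × ℝ³) => qCut y.1) x := by
    have hq' : ContDiff ℝ n∞ qCut := by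
      unfold qCut
      exact ((gBump2.contDiff.comp ((contDiff_norm_sq ℝ).comp contDiff_fst)).mul
        (gBump2.contDiff.comp ((contDiff_norm_sq ℝ).comp (contDiff_fst.comp contDiff_snd)))).mul
        (gBump2.contDiff.comp ((contDiff_norm_sq ℝ).comp (contDiff_snd.comp contDiff_snd)))
    have h := hq'.contDiffAt.comp x (contDiffAt_fst (E := ℍ × ℍ × ℍ) (F := ℝ³ × ℝ³))
    exact h
  have hpRad : ContDiffAt ℝ n∞ (fun y : (ℍ × ℍ × ℍ) × (ℝ³ × ℝ³) => pRadAt ξ hε y.2) x := by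
    unfold pRadAt
    exact (((hnorm 0).mul (hnorm 1)).mul (hnorm 2)).mul
      ((((kappaBumpAt ξ hε 0).contDiff.contDiffAt.comp x (hnorm 0)).mul
        ((kappaBumpAt ξ hε 1).contDiff.contDiffAt.comp x (hnorm 1))).mul
        ((kappaBumpAt ξ hε 2).contDiff.contDiffAt.comp x (hnorm 2)))
  have hnVec : ContDiffAt ℝ n∞ (fun y : (ℍ × ℍ × ℍ) × (ℝ³ × ℝ³) => nVec y.2) x := by
    have hF : ContDiffAt ℝ n∞ (fun y : (ℍ × ℍ × ℍ) × (ℝ³ × ℝ³) => freq3 y.2) x :=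
      contDiff_freq3.contDiffAt.comp x contDiffAt_snd
    have h := (contDiffAt_gammaNormal (n := n∞) hcr).comp x hF
    exact h
  have hpFrame : ContDiffAt ℝ n∞ (fun y : (ℍ × ℍ × ℍ) × (ℝ³ × ℝ³) => pFrame hε y.2) x := by
    have hf2 : ContDiffAt ℝ n∞ (fun y : (ℍ × ℍ × ℍ) × (ℝ³ × ℝ³) => freq3 y.2 2) x :=
      (contDiff_freq3_apply 2).contDiffAt.comp x contDiffAt_snd
    have hu : ContDiffAt ℝ n∞ (fun y : (ℍ × ℍ × ℍ) × (ℝ³ × ℝ³) => udir (freq3 y.2 2)) x := by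
      have h := (contDiffAt_udir (n := n∞) (hne 2)).comp x hf2
      exact h
    have hd : ContDiffAt ℝ n∞ (fun y : (ℍ × ℍ × ℍ) × (ℝ³ × ℝ³) => (dirBump hε) (udir (freq3 y.2 2))) x := by
      have h := (dirBump hε).contDiff.contDiffAt.comp x hu
      exact h
    have hn' : ContDiffAt ℝ n∞ (fun y : (ℍ × ℍ × ℍ) × (ℝ³ × ℝ³) => (normalBump hε) (nVec y.2)) x := by
      have h := (normalBump hε).contDiff.contDiffAt.comp x hnVec
      exact h
    unfold pFrame
    exact hd.mul hn'
  have hzeta : ∀ j, ContDiffAt ℝ n∞ (fun y : (ℍ × ℍ × ℍ) × (ℝ³ × ℝ³) => zetaVec y.1 y.2 j) x := by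
    intro j
    unfold zetaVec
    have hs : ContDiffAt ℝ n∞ (fun y : (ℍ × ℍ × ℍ) × (ℝ³ × ℝ³) => (star (slotQ y.1 j), freq3 y.2 j)) x :=
      ((contDiff_quat_star.comp (contDiff_slotQ j)).contDiffAt.comp x contDiffAt_fst).prodMk
        ((contDiff_freq3_apply j).contDiffAt.comp x contDiffAt_snd)
    have hne0 : (star (slotQ x.1 j), freq3 x.2 j).1 ≠ 0 := by
      simpa using hq j
    have h := (contDiffAt_qrotFun (n := n∞) hne0).comp x hs
    exact h
  have hzCut : ContDiffAt ℝ n∞ (fun y : (ℍ × ℍ × ℍ) × (ℝ³ × ℝ³) => zCutAt ξ hε y.1 y.2) x := by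
    unfold zCutAt
    exact (((zetaBumpAt ξ hε 0).contDiff.contDiffAt.comp x (hzeta 0)).mul
      ((zetaBumpAt ξ hε 1).contDiff.contDiffAt.comp x (hzeta 1))).mul
      ((zetaBumpAt ξ hε 2).contDiff.contDiffAt.comp x (hzeta 2))
  unfold realCutAt
  exact (((hqCut.mul hpRad).mul hpFrame).mul hzCut).mul contDiffAt_const

/-- **Smoothness of the synthesis sum on the good set about `ξ`** (given (3.24) within `δ`; the
tree's `contDiffAt_Ssum` with `ndDelta_spec` replaced by `NondegWithin ξ δ`). [cite: Tao2016AveragedNS, §3.6 p. 18] -/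
theorem contDiffAt_Ssum_at (hnd : NondegWithin ξ δ) {x : (ℍ × ℍ × ℍ) × (ℝ³ × ℝ³)} (hx : x ∈ GoodSetAt ξ δ) :
    ContDiffAt ℝ n∞ (fun y : (ℍ × ℍ × ℍ) × (ℝ³ × ℝ³) => Ssum ψ y.1 y.2) x := by
  obtain ⟨hq, hp⟩ := hx
  obtain ⟨hne, hcr, -, -, hlam⟩ := hnd (freq3 x.2) hp (freq3_sum x.2)
  have hf : ∀ j, ContDiffAt ℝ n∞ (fun y : (ℍ × ℍ × ℍ) × (ℝ³ × ℝ³) => freq3 y.2 j) x := fun j =>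
    (contDiff_freq3_apply j).contDiffAt.comp x contDiffAt_snd
  have hnVec : ContDiffAt ℝ n∞ (fun y : (ℍ × ℍ × ℍ) × (ℝ³ × ℝ³) => nVec y.2) x := by
    have hF : ContDiffAt ℝ n∞ (fun y : (ℍ × ℍ × ℍ) × (ℝ³ × ℝ³) => freq3 y.2) x :=
      contDiff_freq3.contDiffAt.comp x contDiffAt_snd
    have h := (contDiffAt_gammaNormal (n := n∞) hcr).comp x hF
    exact h
  have hW : ∀ j s, ContDiffAt ℝ n∞ (fun y : (ℍ × ℍ × ℍ) × (ℝ³ × ℝ³) => Wvec y.2 j s) x := by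
    intro j s
    unfold Wvec
    have hne0 : (freq3 x.2 j, nVec x.2).1 ≠ 0 := hne j
    have h := (contDiffAt_frameW hne0 s).comp x ((hf j).prodMk hnVec)
    exact h
  have hlamP : ∀ σ, ContDiffAt ℝ n∞ (fun y : (ℍ × ℍ × ℍ) × (ℝ³ × ℝ³) => lamP y.2 σ) x := by
    intro σ
    unfold lamP lambdaSigma
    have hW' : ∀ j s, ContDiffAt ℝ n∞ (fun y : (ℍ × ℍ × ℍ) × (ℝ³ × ℝ³) => frameW (freq3 y.2 j) (nVec y.2) s) x := hW
    exact contDiffAt_Lambda (hf 0) (hf 1) (hW' 0 (σ 0)) (hW' 1 (σ 1)) (hW' 2 (σ 2))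
  have hzeta : ∀ j, ContDiffAt ℝ n∞ (fun y : (ℍ × ℍ × ℍ) × (ℝ³ × ℝ³) => zetaVec y.1 y.2 j) x := by
    intro j
    unfold zetaVec
    have hs : ContDiffAt ℝ n∞ (fun y : (ℍ × ℍ × ℍ) × (ℝ³ × ℝ³) => (star (slotQ y.1 j), freq3 y.2 j)) x :=
      ((contDiff_quat_star.comp (contDiff_slotQ j)).contDiffAt.comp x contDiffAt_fst).prodMk (hf j)
    have hne0 : (star (slotQ x.1 j), freq3 x.2 j).1 ≠ 0 := by simpa using hq j
    have h := (contDiffAt_qrotFun (n := n∞) hne0).comp x hs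
    exact h
  have hzne : ∀ j, zetaVec x.1 x.2 j ≠ 0 := by
    intro j h0
    have : ‖zetaVec x.1 x.2 j‖ = ‖freq3 x.2 j‖ := by
      unfold zetaVec; rw [norm_qrotFun (star_ne_zero.mpr (hq j))]
    rw [h0, norm_zero] at this
    exact hne j (norm_eq_zero.mp this.symm)
  have hcVec : ∀ j, ContDiffAt ℝ n∞ (fun y : (ℍ × ℍ × ℍ) × (ℝ³ × ℝ³) => cVec ψ y.1 y.2 j) x := by
    intro j
    unfold cVec
    have hinner : ContDiffAt ℝ n∞ (fun y : (ℍ × ℍ × ℍ) × (ℝ³ × ℝ³) =>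
        projPerp (zetaVec y.1 y.2 j) (aVec ψ j (zetaVec y.1 y.2 j))) x := by
      have hne0 : (zetaVec x.1 x.2 j, aVec ψ j (zetaVec x.1 x.2 j)).1 ≠ 0 := hzne j
      have ha : ContDiffAt ℝ n∞ (fun y : (ℍ × ℍ × ℍ) × (ℝ³ × ℝ³) => aVec ψ j (zetaVec y.1 y.2 j)) x :=
        (contDiff_aVec ψ j).contDiffAt.comp x (hzeta j)
      have h := (contDiffAt_projPerp hne0).comp x ((hzeta j).prodMk ha)
      exact h
    have hne1 : (slotQ x.1 j, projPerp (zetaVec x.1 x.2 j) (aVec ψ j (zetaVec x.1 x.2 j))).1 ≠ 0 := hq j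
    have hsl : ContDiffAt ℝ n∞ (fun y : (ℍ × ℍ × ℍ) × (ℝ³ × ℝ³) => slotQ y.1 j) x :=
      (contDiff_slotQ j).contDiffAt.comp x contDiffAt_fst
    have h := (contDiffAt_rotMat_qrot hne1).comp x (hsl.prodMk hinner)
    exact h
  have hterm : ∀ σ : Fin 3 → ℤˣ, ContDiffAt ℝ n∞ (fun y : (ℍ × ℍ × ℍ) × (ℝ³ × ℝ³) =>
      (lamP y.2 σ)⁻¹ * ∏ j, cdot (Wvec y.2 j (σ j)) (cVec ψ y.1 y.2 j)) x := by
    intro σ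
    have hprod : ContDiffAt ℝ n∞ (fun y : (ℍ × ℍ × ℍ) × (ℝ³ × ℝ³) =>
        ∏ j, cdot (Wvec y.2 j (σ j)) (cVec ψ y.1 y.2 j)) x := by
      have : (fun y : (ℍ × ℍ × ℍ) × (ℝ³ × ℝ³) => ∏ j, cdot (Wvec y.2 j (σ j)) (cVec ψ y.1 y.2 j)) =
          fun y => cdot (Wvec y.2 0 (σ 0)) (cVec ψ y.1 y.2 0) * cdot (Wvec y.2 1 (σ 1)) (cVec ψ y.1 y.2 1) *
            cdot (Wvec y.2 2 (σ 2)) (cVec ψ y.1 y.2 2) := by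
        funext y; exact Fin.prod_univ_three _
      rw [this]
      exact ((contDiffAt_cdot (hW 0 (σ 0)) (hcVec 0)).mul (contDiffAt_cdot (hW 1 (σ 1)) (hcVec 1))).mul
        (contDiffAt_cdot (hW 2 (σ 2)) (hcVec 2))
    exact ((hlamP σ).inv (hlam σ)).mul hprod
  unfold Ssum
  exact ContDiffAt.sum fun σ _ => hterm σ

/-- **Smoothness of the joint weight `FflatAt` on `Q × (ℝ³)²`** about a frame triple, for
`ε₀ ≤ 1/100` and (3.24) within a radius `δ > 5500 ε₀³`. [cite: Tao2016AveragedNS, §3.6 p. 18] -/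
theorem contDiff_FflatAt (hξ : IsFrameTriple ξ) (hε : 0 < ε₀) (hε1 : ε₀ ≤ 1 / 100) (hnd : NondegWithin ξ δ)
    (hδ : 5500 * ε₀ ^ 3 < δ) :
    ContDiff ℝ n∞ fun x : (ℍ × ℍ × ℍ) × (ℝ³ × ℝ³) => FflatAt ξ ψ hε x.1 x.2 := by
  refine contDiff_iff_contDiffAt.2 fun x => ?_
  by_cases hx : x ∈ GoodSetAt ξ δ
  · unfold FflatAt
    exact (Complex.ofRealCLM.contDiff.contDiffAt.comp x (contDiffAt_realCutAt hε hnd hx)).mul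
      (contDiffAt_Ssum_at hnd hx)
  · -- near a bad point the weight vanishes identically
    have hzero : ∀ᶠ y in nhds x, FflatAt ξ ψ hε y.1 y.2 = 0 := by
      simp only [GoodSetAt, mem_setOf_eq, not_and_or, not_forall, not_not, not_lt] at hx
      rcases hx with ⟨j, hj⟩ | ⟨j, hj⟩
      · -- `qⱼ = 0`
        have hopen : ∀ᶠ y in nhds x, ‖slotQ y.1 j‖ < 1 / 2 := by
          have hc : Continuous fun y : (ℍ × ℍ × ℍ) × (ℝ³ × ℝ³) => ‖slotQ y.1 j‖ :=
            ((contDiff_slotQ j).continuous.comp continuous_fst).norm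
          refine (isOpen_lt hc continuous_const).mem_nhds ?_
          simp [hj]
        filter_upwards [hopen] with y hy
        unfold FflatAt realCutAt
        rw [qCut_eq_zero_of_norm_lt hy]; simp only [zero_mul, Complex.ofReal_zero]
      · -- `ζ` far from the base
        have hopen : ∀ᶠ y in nhds x, 5500 * ε₀ ^ 3 < ‖freq3 y.2 j - ξ j‖ := by
          have hc : Continuous fun y : (ℍ × ℍ × ℍ) × (ℝ³ × ℝ³) => ‖freq3 y.2 j - ξ j‖ :=
            (((contDiff_freq3_apply j).continuous.comp continuous_snd).sub continuous_const).norm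
          refine (isOpen_lt continuous_const hc).mem_nhds ?_
          show 5500 * ε₀ ^ 3 < ‖freq3 x.2 j - ξ j‖
          exact lt_of_lt_of_le hδ hj
        filter_upwards [hopen] with y hy
        unfold FflatAt realCutAt
        by_cases hR : pRadAt ξ hε y.2 = 0
        · rw [hR]; simp only [mul_zero, zero_mul, Complex.ofReal_zero]
        by_cases hB : pFrame hε y.2 = 0
        · rw [hB]; simp only [mul_zero, zero_mul, Complex.ofReal_zero]
        exact absurd (near_base_of_cutoffs hξ hε hε1 hR hB j) (not_le.mpr hy)
    exact (contDiffAt_const (c := (0 : ℂ))).congr_of_eventuallyEq hzero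

/-- **Smoothness of `F` about `ξ` on `V × (ℝ³)²`.** [cite: Tao2016AveragedNS, §3.6 p. 18] -/
theorem contDiff_jointFAt (hξ : IsFrameTriple ξ) (hε : 0 < ε₀) (hε1 : ε₀ ≤ 1 / 100) (hnd : NondegWithin ξ δ)
    (hδ : 5500 * ε₀ ^ 3 < δ) : ContDiff ℝ n∞ (jointFAt ξ ψ hε) := by
  have e : jointFAt ξ ψ hε = (fun x : (ℍ × ℍ × ℍ) × (ℝ³ × ℝ³) => FflatAt ξ ψ hε x.1 x.2) ∘
      fun x : (Fin 4 → ℝ³) × (ℝ³ × ℝ³) => (quatTripleCLE x.1, x.2) := by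
    funext x; rfl
  rw [e]
  exact (contDiff_FflatAt hξ hε hε1 hnd hδ).comp ((quatTripleCLE.contDiff.comp contDiff_fst).prodMk contDiff_snd)

/-! ### Compact support -/

/-- The weight vanishes unless all `|qⱼ| ≤ 2` and `|ζⱼ - ξ j| ≤ 1` (`j = 1, 2`). [cite: Tao2016AveragedNS, §3.6 p. 18] -/
theorem FflatAt_eq_zero_of_far (hξ : IsFrameTriple ξ) (hε : 0 < ε₀) (hε1 : ε₀ ≤ 1 / 100)
    {q : ℍ × ℍ × ℍ} {p : ℝ³ × ℝ³}
    (h : (2 : ℝ) < ‖q.1‖ ∨ (2 : ℝ) < ‖q.2.1‖ ∨ (2 : ℝ) < ‖q.2.2‖ ∨ (1 : ℝ) < ‖p.1 - ξ 0‖ ∨ (1 : ℝ) < ‖p.2 - ξ 1‖) :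
    FflatAt ξ ψ hε q p = 0 := by
  have key : ∀ t : ℝ, 2 < t → (gBump2 : ℝ → ℝ) (t ^ 2) = 0 := by
    intro t ht
    apply gBump2.zero_of_le_dist
    rw [Real.dist_eq, show gBump2.rOut = 3 / 4 from rfl, abs_of_pos (by nlinarith)]
    nlinarith
  have ht1 : 5500 * ε₀ ^ 3 < 1 := by
    calc 5500 * ε₀ ^ 3 ≤ 5500 * (1 / 100) ^ 3 := by gcongr
      _ < 1 := by norm_num
  unfold FflatAt realCutAt qCut
  rcases h with h | h | h | h | h
  · rw [key _ h]; simp only [zero_mul, Complex.ofReal_zero]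
  · rw [key _ h]; simp only [zero_mul, mul_zero, Complex.ofReal_zero]
  · rw [key _ h]; simp only [mul_zero, zero_mul, Complex.ofReal_zero]
  · by_cases hR : pRadAt ξ hε p = 0
    · rw [hR]; simp only [zero_mul, mul_zero, Complex.ofReal_zero]
    by_cases hB : pFrame hε p = 0
    · rw [hB]; simp only [zero_mul, mul_zero, Complex.ofReal_zero]
    have := near_base_of_cutoffs hξ hε hε1 hR hB 0
    rw [freq3_zero] at this
    linarith
  · by_cases hR : pRadAt ξ hε p = 0
    · rw [hR]; simp only [zero_mul, mul_zero, Complex.ofReal_zero]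
    by_cases hB : pFrame hε p = 0
    · rw [hB]; simp only [zero_mul, mul_zero, Complex.ofReal_zero]
    have := near_base_of_cutoffs hξ hε hε1 hR hB 1
    rw [freq3_one] at this
    linarith

/-- **`FflatAt` has compact support.** [cite: Tao2016AveragedNS, §3.6 p. 18] -/
theorem hasCompactSupport_FflatAt (hξ : IsFrameTriple ξ) (hε : 0 < ε₀) (hε1 : ε₀ ≤ 1 / 100) :
    HasCompactSupport fun x : (ℍ × ℍ × ℍ) × (ℝ³ × ℝ³) => FflatAt ξ ψ hε x.1 x.2 := by
  set K : Set ((ℍ × ℍ × ℍ) × (ℝ³ × ℝ³)) :=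
    (Metric.closedBall 0 2 ×ˢ (Metric.closedBall 0 2 ×ˢ Metric.closedBall 0 2)) ×ˢ
      (Metric.closedBall (ξ 0) 1 ×ˢ Metric.closedBall (ξ 1) 1)
  have hK : IsCompact K :=
    ((isCompact_closedBall _ _).prod ((isCompact_closedBall _ _).prod (isCompact_closedBall _ _))).prod
      ((isCompact_closedBall _ _).prod (isCompact_closedBall _ _))
  refine HasCompactSupport.intro hK fun x hx => ?_
  apply FflatAt_eq_zero_of_far hξ hε hε1
  simp only [K, mem_prod, Metric.mem_closedBall, dist_eq_norm, sub_zero, not_and_or, not_le] at hx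
  tauto

/-- **`F` about `ξ` has compact support.** [cite: Tao2016AveragedNS, §3.6 p. 18] -/
theorem hasCompactSupport_jointFAt (hξ : IsFrameTriple ξ) (hε : 0 < ε₀) (hε1 : ε₀ ≤ 1 / 100) :
    HasCompactSupport (jointFAt ξ ψ hε) := by
  have h := (hasCompactSupport_FflatAt (ψ := ψ) hξ hε hε1).comp_homeomorph
    (quatTripleCLE.toHomeomorph.prodCongr (Homeomorph.refl (ℝ³ × ℝ³)))
  have e : jointFAt ξ ψ hε = (fun x : (ℍ × ℍ × ℍ) × (ℝ³ × ℝ³) => FflatAt ξ ψ hε x.1 x.2) ∘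
      ⇑(quatTripleCLE.toHomeomorph.prodCongr (Homeomorph.refl (ℝ³ × ℝ³))) := by
    funext x; rfl
  rw [e]; exact h

end Smooth
end Literature.Analysis.FluidPDE.Tao2016
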